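import Summits.Ventures.PercRepro.C026SuperAdd

/-!
# Independence across a cut (p6, gen 15)

An event that depends only on the edges of `S` (`DependsOn S`) and one that depends only on the other
edges are independent under the product law (`prob_inter_eq_mul_of_dependsOn`): the weight factorises
along `S`/`Sᶜ` (`weight_eq_mul_split`) and the configuration space splits as a product
(`splitConfig`).  The bookkeeping behind mine-3's bridge case of SA (`C026BridgeSA`) and, more
generally, behind every «two independent sides» argument of the lane.
-/

namespace PercRepro

open Finset

/-! ### Independence across a cut -/

section Indep

variable {E : Type*} [Fintype E] [DecidableEq E]

/-- An event **depends only on the edges of `S`**: its membership is insensitive to the other edges. -/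
def DependsOn (S : Finset E) (A : Set (Config E)) : Prop :=
  ∀ ω ω' : Config E, (∀ e ∈ S, ω e = ω' e) → (ω ∈ A ↔ ω' ∈ A)

/-- Splitting a configuration into its `S`-part and its `Sᶜ`-part. -/
def splitConfig (S : Finset E) :
    Config E ≃ ((e : {e // e ∈ S}) → Bool) × ((e : {e // e ∉ S}) → Bool) :=
  Equiv.piEquivPiSubtypeProd (fun e => e ∈ S) (fun _ => Bool)

/-- The weight factorises over `S` and its complement, as weights of the two restricted configurations. -/
theorem weight_eq_mul_split (p : E → ℝ) (S : Finset E) (ω : Config E) :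
    weight p ω = weight (fun e : {e // e ∈ S} => p e) ((splitConfig S ω).1) *
      weight (fun e : {e // e ∉ S} => p e) ((splitConfig S ω).2) := by
  unfold weight
  rw [← Finset.prod_mul_prod_compl S]
  congr 1
  · rw [Finset.prod_subtype S (fun _ => Iff.rfl)]
    rfl
  · rw [Finset.prod_subtype Sᶜ (fun x => Finset.mem_compl)]
    rfl

/-- **Independence across a cut**: events determined by disjoint edge sets are independent. -/
theorem prob_inter_eq_mul_of_dependsOn (p : E → ℝ) {S : Finset E} {A B : Set (Config E)}
    (hA : DependsOn S A) (hB : DependsOn Sᶜ B) :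
    prob p (A ∩ B) = prob p A * prob p B := by
  classical
  let fA : ((e : {e // e ∈ S}) → Bool) → ℝ := fun σ =>
    A.indicator (fun _ => (1 : ℝ)) ((splitConfig S).symm (σ, fun _ => false))
  let fB : ((e : {e // e ∉ S}) → Bool) → ℝ := fun τ =>
    B.indicator (fun _ => (1 : ℝ)) ((splitConfig S).symm (fun _ => false, τ))
  have hfA : ∀ ω : Config E, A.indicator (fun _ => (1 : ℝ)) ω = fA (splitConfig S ω).1 := by
    intro ω
    have hmem : ω ∈ A ↔ (splitConfig S).symm ((splitConfig S ω).1, fun _ => false) ∈ A := by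
      refine hA ω _ fun x hx => ?_
      simp [splitConfig, Equiv.piEquivPiSubtypeProd, hx]
    by_cases h : ω ∈ A
    · simp [fA, Set.indicator_of_mem h, Set.indicator_of_mem (hmem.1 h)]
    · simp [fA, Set.indicator_of_notMem h, Set.indicator_of_notMem (fun h' => h (hmem.2 h'))]
  have hfB : ∀ ω : Config E, B.indicator (fun _ => (1 : ℝ)) ω = fB (splitConfig S ω).2 := by
    intro ω
    have hmem : ω ∈ B ↔ (splitConfig S).symm (fun _ => false, (splitConfig S ω).2) ∈ B := by
      refine hB ω _ fun x hx => ?_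
      have hx' : x ∉ S := Finset.mem_compl.1 hx
      simp [splitConfig, Equiv.piEquivPiSubtypeProd, hx']
    by_cases h : ω ∈ B
    · simp [fB, Set.indicator_of_mem h, Set.indicator_of_mem (hmem.1 h)]
    · simp [fB, Set.indicator_of_notMem h, Set.indicator_of_notMem (fun h' => h (hmem.2 h'))]
  have hind : ∀ (X : Set (Config E)) (ω : Config E),
      X.indicator (weight p) ω = X.indicator (fun _ => (1 : ℝ)) ω * weight p ω := by
    intro X ω
    by_cases h : ω ∈ X <;> simp [Set.indicator, h]
  have hAB : ∀ ω : Config E, (A ∩ B).indicator (fun _ => (1 : ℝ)) ω =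
      A.indicator (fun _ => (1 : ℝ)) ω * B.indicator (fun _ => (1 : ℝ)) ω := by
    intro ω
    by_cases h1 : ω ∈ A <;> by_cases h2 : ω ∈ B <;> simp [Set.indicator, h1, h2]
  set wS := weight (fun e : {e // e ∈ S} => p e) with hwS
  set wT := weight (fun e : {e // e ∉ S} => p e) with hwT
  have hsumT : ∑ τ, wT τ = 1 := sum_weight _
  have hsumS : ∑ σ, wS σ = 1 := sum_weight _
  have hPAB : prob p (A ∩ B) = (∑ σ, fA σ * wS σ) * (∑ τ, fB τ * wT τ) := by
    unfold prob
    rw [Finset.sum_mul_sum, ← Fintype.sum_prod_type', ← (splitConfig S).sum_comp]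
    refine Finset.sum_congr rfl fun ω _ => ?_
    rw [hind, hAB, hfA, hfB, weight_eq_mul_split p S]
    ring
  have hPA : prob p A = ∑ σ, fA σ * wS σ := by
    unfold prob
    have : ∑ ω, A.indicator (weight p) ω = (∑ σ, fA σ * wS σ) * (∑ τ, wT τ) := by
      rw [Finset.sum_mul_sum, ← Fintype.sum_prod_type', ← (splitConfig S).sum_comp]
      refine Finset.sum_congr rfl fun ω _ => ?_
      rw [hind, hfA, weight_eq_mul_split p S]
      ring
    rw [this, hsumT, mul_one]
  have hPB : prob p B = ∑ τ, fB τ * wT τ := by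
    unfold prob
    have : ∑ ω, B.indicator (weight p) ω = (∑ σ, wS σ) * (∑ τ, fB τ * wT τ) := by
      rw [Finset.sum_mul_sum, ← Fintype.sum_prod_type', ← (splitConfig S).sum_comp]
      refine Finset.sum_congr rfl fun ω _ => ?_
      rw [hind, hfB, weight_eq_mul_split p S]
      ring
    rw [this, hsumS, one_mul]
  rw [hPAB, hPA, hPB]

omit [Fintype E] [DecidableEq E] in
/-- Intersections of events depending on `S` depend on `S`. -/
theorem DependsOn.inter {S : Finset E} {A B : Set (Config E)} (hA : DependsOn S A)
    (hB : DependsOn S B) : DependsOn S (A ∩ B) :=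
  fun ω ω' h => by simp only [Set.mem_inter_iff, hA ω ω' h, hB ω ω' h]

omit [Fintype E] [DecidableEq E] in
/-- Complements of events depending on `S` depend on `S`. -/
theorem DependsOn.compl {S : Finset E} {A : Set (Config E)} (hA : DependsOn S A) :
    DependsOn S Aᶜ :=
  fun ω ω' h => by simp only [Set.mem_compl_iff, hA ω ω' h]

end Indep

end PercRepro
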